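import Summits.PneNP.PneNP.Theses.StraightLineSign
import Literature.Computability.AlgebraicComplexity.PosSLP
import Literature.Computability.Complexity.CountingHierarchy
import Literature.Computability.Complexity.CountingHierarchyProofs
import Literature.Computability.Complexity.CountingHierarchyPH
import Literature.Computability.Complexity.CountingHierarchyPSPACE
import Literature.Computability.Complexity.TodaPartOne
import Literature.Computability.Complexity.TodaPartTwo
import Literature.Computability.Complexity.PRelHierarchy
import Literature.Computability.Complexity.NPClosureProofs
import Literature.Computability.Complexity.Reductions

/-!
# Redirect r1 — POSITION LEMMAS for the crux `PosSLPInPH` (stmt-PneNP-18282) relative to the summit `PneNP`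

Strategist evidence (planner-cstrat-stmt-PneNP-18282-r1-0, 2026-08-17). All theorems below are
sorry-free. Write `C := PosSLPInPH` (`posSLP ∈ PH`, definitionally) and `S := PneNP` (`P ≠ NP`).
The only non-tree input is ABKM 2009 Thm 1.4 in its vendored CH form, the NAMED FACT
`AllenderEtAl2009_posSLP_mem_CH : Prop := posSLP ∈ CH`, always carried as an explicit hypothesis.

The four corners (what the cheap `C → S` / `S → C` probes cannot see, certified):

* `C ∧ ¬S` follows from `PP = P` (given ABKM Thm 1.4):          `C_of_PP_eq_P`, `notS_of_PP_eq_P`;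
  hence ANY proof of `C → S` is a proof of `PP ≠ P`:            `PP_ne_P_of_C_imp_S`.
* `¬C ∧ S` follows from "posSLP is PP-hard (Karp) and PH is infinite" (Toda, in tree):
                                                                 `notC_of_PPhard_of_PH_infinite`, `S_of_PH_infinite`;
  hence ANY proof of `S → C` refutes that live scenario:         `not_PPhard_and_PHinfinite_of_S_imp_C`.
* `C` also follows from `PH = PSPACE` (given ABKM Thm 1.4):      `C_of_PH_eq_PSPACE` (a world compatible with `S`).

So `C` is logically ORTHOGONAL to `S` modulo standard separations: it is neither the summit in
costume (`C → S` costs `PP ≠ P`) nor a mere consequence of it (`S → C` costs ruling out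
PP-hardness of PosSLP with an infinite PH).
-/

namespace Summit.PneNP.PneNP.Cruxes.PosSLPInPH.Redirect

open Literature.Computability.Complexity
open Literature.Computability.AlgebraicComplexity
open Summit.PneNP.PneNP.Theses.StraightLineSign
open scoped Literature.Computability.Complexity.Notation

/-- The crux IS `posSLP ∈ PH`. -/
theorem crux_iff : PosSLPInPH ↔ posSLP ∈ PH := Iff.rfl

/-- `¬ PneNP` unfolds, through the proved Bool bridges, to `NP ⊆ P` (tree classes). -/
theorem NP_subset_P_of_not_PneNP (h : ¬ _root_.PneNP) : Nondeterministic.NP ⊆ Classes.P := by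
  intro L hL
  by_contra hL'
  apply h
  refine ⟨L, ?_, ?_⟩
  · rw [NP_bool_eq_holds]; exact hL
  · rw [P_bool_eq_holds]; exact hL'

/-- Conversely `NP ⊆ P` refutes `PneNP`. -/
theorem not_PneNP_of_NP_subset_P (h : Nondeterministic.NP ⊆ Classes.P) : ¬ _root_.PneNP := by
  rintro ⟨L, hL, hL'⟩
  apply hL'
  rw [P_bool_eq_holds]
  apply h
  rw [← NP_bool_eq_holds]; exact hL

/-- Corner 1a: `PP = P ⟹ ¬S` (since `NP ⊆ PP`, Gill; tree theorem `NP_subset_PP_holds`). -/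
theorem notS_of_PP_eq_P (h : PP = Classes.P) : ¬ _root_.PneNP :=
  not_PneNP_of_NP_subset_P (fun L hL => h ▸ NP_subset_PP_holds hL)

/-- Corner 1b: `PP = P ⟹ C` given ABKM Thm 1.4 (`posSLP ∈ CH`): `CH = P ⊆ PH`. -/
theorem C_of_PP_eq_P (hCH : AllenderEtAl2009_posSLP_mem_CH) (h : PP = Classes.P) : PosSLPInPH := by
  rw [crux_iff]
  have h1 : posSLP ∈ Classes.P := by
    have := hCH
    unfold AllenderEtAl2009_posSLP_mem_CH at this
    rwa [CH_eq_P_of_PP_eq_P h] at this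
  exact P_subset_PH h1

/-- **Certificate for the failed `C → S` probe.** Any proof of `PosSLPInPH → PneNP` is, together
with ABKM Thm 1.4, a proof of `PP ≠ P`. -/
theorem PP_ne_P_of_C_imp_S (hCH : AllenderEtAl2009_posSLP_mem_CH)
    (himp : PosSLPInPH → _root_.PneNP) : PP ≠ Classes.P :=
  fun h => notS_of_PP_eq_P h (himp (C_of_PP_eq_P hCH h))

/-- Corner 3: `PH = PSPACE ⟹ C` given ABKM Thm 1.4 (`CH ⊆ PSPACE`, tree theorem). A world with
`P ≠ NP = PSPACE` has `C ∧ S`. -/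
theorem C_of_PH_eq_PSPACE (hCH : AllenderEtAl2009_posSLP_mem_CH) (h : PH = PSPACE) : PosSLPInPH := by
  rw [crux_iff, h]
  exact CH_subset_PSPACE_holds hCH

/-- `P = NP ⟹ Σₖ = P` for every `k` (Meyer–Stockmeyer; same induction as the route's `closes`). -/
theorem SigmaP_eq_P_of_NP_subset_P (hsub : Nondeterministic.NP ⊆ Classes.P) (k : ℕ) :
    SigmaP k = Classes.P := by
  have heq : Classes.P = Nondeterministic.NP := (Set.Subset.antisymm hsub P_subset_NP_holds).symm
  have hNP : polyExists Classes.P = Nondeterministic.NP := by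
    have h1 : SigmaP 1 = Nondeterministic.NP := SigmaP_one_holds
    rw [SigmaP_succ, PiP_eq_co, SigmaP_zero, show co Classes.P = Classes.P from co_P_holds] at h1
    exact h1
  induction k with
  | zero => rfl
  | succ k ih =>
    rw [SigmaP_succ, PiP_eq_co, ih, show co Classes.P = Classes.P from co_P_holds, hNP]
    exact heq.symm

/-- Corner 2a: an infinite polynomial hierarchy gives `S`. -/
theorem S_of_PH_infinite (hinf : ∀ k, SigmaP k ≠ PH) : _root_.PneNP := by
  by_contra h
  have hk := SigmaP_eq_P_of_NP_subset_P (NP_subset_P_of_not_PneNP h)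
  apply hinf 0
  apply Set.Subset.antisymm (SigmaP_subset_PH 0)
  intro L hL
  obtain ⟨k, hk'⟩ := Set.mem_iUnion.1 hL
  rw [hk k] at hk'
  rw [hk 0]
  exact hk'

/-- Toda (in tree: `PH ⊆ BP·⊕P ⊆ P^PP`) + Stockmeyer (`A ∈ Σₖ ⇒ P^A ⊆ Σₖ₊₂`, in tree):
`PP ⊆ Σₖ ⟹ PH ⊆ Σₖ₊₂`. -/
theorem PH_subset_SigmaP_of_PP_subset (k : ℕ) (h : PP ⊆ SigmaP k) : PH ⊆ SigmaP (k + 2) := by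
  intro L hL
  have h1 : L ∈ PRelClass PP := bp_ParityP_subset_PRelClass_PP_holds (PH_subset_bp_ParityP hL)
  simp only [PRelClass, Set.mem_iUnion] at h1
  obtain ⟨A, hA, hLA⟩ := h1
  exact PRel_ofLanguage_subset_SigmaP_add_two (h hA) hLA

/-- Corner 2b: if `posSLP` is PP-hard under Karp reductions and PH is infinite then `¬C`. -/
theorem notC_of_PPhard_of_PH_infinite (hhard : ∀ L ∈ PP, L ≤ₚ posSLP)
    (hinf : ∀ k, SigmaP k ≠ PH) : ¬ PosSLPInPH := by
  intro hC
  rw [crux_iff] at hC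
  obtain ⟨m, hm⟩ := Set.mem_iUnion.1 hC
  have hPP : PP ⊆ SigmaP m := by
    intro L hL
    obtain ⟨f, hf, hred⟩ := polyTimeKarpReducible_iff.1 (hhard L hL)
    have : L = f ⁻¹' posSLP := Set.ext fun x => hred x
    rw [this]
    exact preimage_mem_SigmaP hm hf
  exact hinf (m + 2) (Set.Subset.antisymm (SigmaP_subset_PH _) (PH_subset_SigmaP_of_PP_subset m hPP))

/-- **Certificate for the `S → C` direction.** Any proof of `PneNP → PosSLPInPH` refutes the live
scenario "PosSLP is PP-hard and PH is infinite" (cf. BitSLP `#P`-hard, ABKM Prop 2.4). -/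
theorem not_PPhard_and_PHinfinite_of_S_imp_C (himp : _root_.PneNP → PosSLPInPH) :
    ¬ ((∀ L ∈ PP, L ≤ₚ posSLP) ∧ (∀ k, SigmaP k ≠ PH)) :=
  fun ⟨hhard, hinf⟩ => notC_of_PPhard_of_PH_infinite hhard hinf (himp (S_of_PH_infinite hinf))

/-- Summary conjunctions (the two informative corners). -/
theorem corner_C_and_notS (hCH : AllenderEtAl2009_posSLP_mem_CH) (h : PP = Classes.P) :
    PosSLPInPH ∧ ¬ _root_.PneNP :=
  ⟨C_of_PP_eq_P hCH h, notS_of_PP_eq_P h⟩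

theorem corner_notC_and_S (hhard : ∀ L ∈ PP, L ≤ₚ posSLP) (hinf : ∀ k, SigmaP k ≠ PH) :
    ¬ PosSLPInPH ∧ _root_.PneNP :=
  ⟨notC_of_PPhard_of_PH_infinite hhard hinf, S_of_PH_infinite hinf⟩

end Summit.PneNP.PneNP.Cruxes.PosSLPInPH.Redirect
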